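import Summits.QuantumFields.YangMills.Theorems.LangevinControlUVOSLegsFromFemtoAndGapStubAssemblyRPObservable
import HarnessLib

/-!
# Soft OS-assembly toolkit XVIII: expansion of the reflection-positivity square into plane-string weights

Helper file for stub `stub_assembly6` of crux `OSLegsFromFemtoAndGap` (stmt-QuantumFields-9367, line
`dlr-collar-transfer`, reshape r2).  For smeared plane-string fields `Xᵢ = fieldObs a Fᵢ m` (toolkit XVII) on the
odd torus:
`E[conj(Σᵢ Xᵢ(ΘU)) · Σⱼ Xⱼ(U)] = Σᵢⱼ Σ_{q,p} Σ_{x,y} conj Fᵢ(a x) Fⱼ(a y) · W^{q ++ p}(θ̃x ++ y)`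
(`wilsonExpectation_rpSquare_eq`), where `W` is the string weight `torusMomentStr` of toolkit VIII-a with the
normalisations `m`, and `θ̃` the orientation-dependent reflected sites of toolkit XVII: the reflection law of the
strings, the product of two strings as the appended string (`strObs_mul_strObs`), and Fubini for finite sums.
-/

noncomputable section

open scoped SchwartzMap BigOperators ComplexConjugate
open MeasureTheory Filter Topology
open Literature.MathematicalPhysics.QuantumFieldTheory Literature.MathematicalPhysics.QuantumLattice
open Literature.MathematicalPhysics.AQFT
open Literature.Probability.LatticeModels (box Site)
open Summit.QuantumFields.YangMills.Cruxes.OSLegsFromFemtoAndGap.DlrCollarTransfer (plane exists_abs_plane_le)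

namespace Summit.QuantumFields.YangMills.Theorems.OSLegsFromFemtoAndGap

local notation "E4" => EuclideanSpace ℝ (Fin 4)

variable {G : Type} [Group G] [TopologicalSpace G] [IsTopologicalGroup G] [CompactSpace G]
  [MeasurableSpace G] [BorelSpace G]

/-! ### Strings: products and expectations -/

omit [IsTopologicalGroup G] [CompactSpace G] [BorelSpace G] in
/-- **The product of two string observables is the appended string.** -/
theorem strObs_mul_strObs (r : LatticeRep G) (L : ℕ) {n k : ℕ} (q : Fin n → Fin 4 × Fin 4) (p : Fin k → Fin 4 × Fin 4)
    (m₁ : Fin n → ℝ) (m₂ : Fin k → ℝ) (x : Fin n → Site 4) (y : Fin k → Site 4) (U : GaugeConfig 4 (2 * L + 1) G) :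
    strObs r L q m₁ x U * strObs r L p m₂ y U =
      strObs r L (Fin.append q p) (Fin.append m₁ m₂) (Fin.append x y) U := by
  unfold strObs
  rw [Fin.prod_univ_add]
  simp only [Fin.append_left, Fin.append_right]

/-- **The expectation of a string observable is the string weight** `torusMomentStr` (definitionally the same
integrand: `plane (q l) (y l) = plaquetteObs r.ρ 0 _ _ ∘ τ_{−y l}`). -/
theorem integral_strObs (r : LatticeRep G) (β : ℝ) (L : ℕ) {n : ℕ} (q : Fin n → Fin 4 × Fin 4) (m : Fin n → ℝ)
    (y : Fin n → Site 4) :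
    ∫ U, strObs r L q m y U ∂(wilsonMeasure (d := 4) (L := 2 * L + 1) r.ρ β) =
      torusMomentStr r.ρ β L (fun l U => plaquetteObs r.ρ 0 (q l).1 (q l).2 U) m y :=
  rfl

/-- String observables are integrable. -/
theorem integrable_strObs (r : LatticeRep G) (β : ℝ) (L : ℕ) {n : ℕ} (q : Fin n → Fin 4 × Fin 4) (m : Fin n → ℝ)
    (y : Fin n → Site 4) : Integrable (strObs r L q m y) (wilsonMeasure (d := 4) (L := 2 * L + 1) r.ρ β) :=
  integrable_prod_plane_sub r β L q y m

/-- The complex summands of the square are integrable. -/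
theorem integrable_rpTerm (r : LatticeRep G) (β : ℝ) (L : ℕ) {n k : ℕ} (c : ℂ) (q : Fin n → Fin 4 × Fin 4)
    (p : Fin k → Fin 4 × Fin 4) (m₁ : Fin n → ℝ) (m₂ : Fin k → ℝ) (x : Fin n → Site 4) (y : Fin k → Site 4) :
    Integrable (fun U : GaugeConfig 4 (2 * L + 1) G => c * ((strObs r L q m₁ x U * strObs r L p m₂ y U : ℝ) : ℂ))
      (wilsonMeasure (d := 4) (L := 2 * L + 1) r.ρ β) := by
  refine Integrable.const_mul ?_ c
  simp_rw [strObs_mul_strObs]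
  exact (integrable_strObs r β L _ _ _).ofReal

/-! ### The expansion -/

/-- **Expansion of the reflection-positivity square into string weights.** -/
theorem wilsonExpectation_rpSquare_eq (r : LatticeRep G) (β : ℝ) (L : ℕ) (a : ℝ) {N : ℕ} {deg : Fin N → ℕ}
    (F : (j : Fin N) → 𝓢((Fin (deg j) → E4), ℂ)) (m : Fin 4 × Fin 4 → ℝ) :
    wilsonExpectation (d := 4) (L := 2 * L + 1) r.ρ β (fun U =>
        conj (∑ j, fieldObs r L a (F j) m U.timeReflect) * ∑ j, fieldObs r L a (F j) m U) =
      ∑ i, ∑ j,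
        ∑ q ∈ Fintype.piFinset (fun _ : Fin (deg i) => Finset.univ.filter fun pl : Fin 4 × Fin 4 => pl.1 < pl.2),
        ∑ p ∈ Fintype.piFinset (fun _ : Fin (deg j) => Finset.univ.filter fun pl : Fin 4 × Fin 4 => pl.1 < pl.2),
        ∑ x ∈ Fintype.piFinset (fun _ : Fin (deg i) => box 4 L),
        ∑ y ∈ Fintype.piFinset (fun _ : Fin (deg j) => box 4 L),
          conj (F i (fun l => a • siteToE (x l))) * F j (fun l => a • siteToE (y l)) *
            (torusMomentStr r.ρ β L
              (fun l U => plaquetteObs r.ρ 0 (Fin.append q p l).1 (Fin.append q p l).2 U)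
              (Fin.append (fun l => m (q l)) (fun l => m (p l)))
              (Fin.append (fun l => thetaSite (q l) (x l)) y) : ℂ) := by
  classical
  -- Step 1: the integrand, pointwise, as a six-fold finite sum
  have hpt : ∀ U : GaugeConfig 4 (2 * L + 1) G,
      conj (∑ j, fieldObs r L a (F j) m U.timeReflect) * ∑ j, fieldObs r L a (F j) m U =
        ∑ i, ∑ j,
          ∑ q ∈ Fintype.piFinset (fun _ : Fin (deg i) => Finset.univ.filter fun pl : Fin 4 × Fin 4 => pl.1 < pl.2),
          ∑ p ∈ Fintype.piFinset (fun _ : Fin (deg j) => Finset.univ.filter fun pl : Fin 4 × Fin 4 => pl.1 < pl.2),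
          ∑ x ∈ Fintype.piFinset (fun _ : Fin (deg i) => box 4 L),
          ∑ y ∈ Fintype.piFinset (fun _ : Fin (deg j) => box 4 L),
            conj (F i (fun l => a • siteToE (x l))) * F j (fun l => a • siteToE (y l)) *
              ((strObs r L q (fun l => m (q l)) (fun l => thetaSite (q l) (x l)) U *
                strObs r L p (fun l => m (p l)) y U : ℝ) : ℂ) := by
    intro U
    simp only [map_sum]
    rw [Finset.sum_mul]
    refine Finset.sum_congr rfl fun i _ => ?_
    rw [Finset.mul_sum]
    refine Finset.sum_congr rfl fun j _ => ?_
    unfold fieldObs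
    simp only [map_sum]
    rw [Finset.sum_mul]
    refine Finset.sum_congr rfl fun q hq => ?_
    rw [Finset.mul_sum]
    refine Finset.sum_congr rfl fun p _ => ?_
    rw [Finset.sum_mul]
    refine Finset.sum_congr rfl fun x _ => ?_
    rw [Finset.mul_sum]
    refine Finset.sum_congr rfl fun y _ => ?_
    rw [map_mul, Complex.conj_ofReal, strObs_timeReflect r L ((mem_planeStrings_iff'' q).1 hq)]
    push_cast
    ring
  -- Step 2: integrate termwise
  unfold wilsonExpectation
  simp_rw [hpt]
  rw [integral_finsetSum _ (fun i _ => ?_)]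
  · refine Finset.sum_congr rfl fun i _ => ?_
    rw [integral_finsetSum _ (fun j _ => ?_)]
    · refine Finset.sum_congr rfl fun j _ => ?_
      rw [integral_finsetSum _ (fun q _ => ?_)]
      · refine Finset.sum_congr rfl fun q _ => ?_
        rw [integral_finsetSum _ (fun p _ => ?_)]
        · refine Finset.sum_congr rfl fun p _ => ?_
          rw [integral_finsetSum _ (fun x _ => ?_)]
          · refine Finset.sum_congr rfl fun x _ => ?_
            rw [integral_finsetSum _ (fun y _ => ?_)]
            · refine Finset.sum_congr rfl fun y _ => ?_
              rw [integral_const_mul]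
              congr 1
              simp_rw [strObs_mul_strObs]
              have hI : ∫ U, ((strObs r L (Fin.append q p) (Fin.append (fun l => m (q l)) (fun l => m (p l)))
                  (Fin.append (fun l => thetaSite (q l) (x l)) y) U : ℝ) : ℂ) ∂(wilsonMeasure (d := 4) (L := 2 * L + 1) r.ρ β) =
                  ((∫ U, strObs r L (Fin.append q p) (Fin.append (fun l => m (q l)) (fun l => m (p l)))
                    (Fin.append (fun l => thetaSite (q l) (x l)) y) U ∂(wilsonMeasure (d := 4) (L := 2 * L + 1) r.ρ β) : ℝ) : ℂ) :=
                integral_ofReal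
              rw [hI, integral_strObs]
            · exact integrable_rpTerm r β L _ q p _ _ _ _
          · exact integrable_finsetSum _ fun y _ => integrable_rpTerm r β L _ q p _ _ _ _
        · exact integrable_finsetSum _ fun x _ => integrable_finsetSum _ fun y _ =>
            integrable_rpTerm r β L _ q p _ _ _ _
      · exact integrable_finsetSum _ fun p _ => integrable_finsetSum _ fun x _ =>
          integrable_finsetSum _ fun y _ => integrable_rpTerm r β L _ q p _ _ _ _
    · exact integrable_finsetSum _ fun q _ => integrable_finsetSum _ fun p _ =>
        integrable_finsetSum _ fun x _ => integrable_finsetSum _ fun y _ => integrable_rpTerm r β L _ q p _ _ _ _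
  · exact integrable_finsetSum _ fun j _ => integrable_finsetSum _ fun q _ => integrable_finsetSum _ fun p _ =>
      integrable_finsetSum _ fun x _ => integrable_finsetSum _ fun y _ => integrable_rpTerm r β L _ q p _ _ _ _

end Summit.QuantumFields.YangMills.Theorems.OSLegsFromFemtoAndGap

end
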